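import Summits.BirchSwinnertonDyer.Rank1Residual.Additive.X3BranchKummerLineClasses
import HarnessLib

/-!
# X3, the DEGENERATE rows OFF the sub-locus: KUMMER classes of elements of a SUBFIELD — the cocycle
# of a `p`-th root of `a ∈ ℚ̄` fixed by a normal subgroup `G' ≤ Γ_ℚ`, its class in `H¹(H, Ψ)` for
# `H ≤ G'`, the CONJUGATION formula `conj_τ[f_{a,β}] = [f_{τa,τβ}]`, membership in GV's `U` from the
# local vanishing of the conjugate cocycles, and injectivity (a class trivial on `G_{ℚ_∞}` has a
# `p`-th root fixed by all of `G'`)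
# (cell `bsd-eis`, seat `bsd-eis-x3` gen 7; sequel of `X3BranchKummerLineClasses.lean` (gen 6, the
# case `a ∈ ℚ`, `G' = Γ_ℚ`); toolkit for the U-side LOWER BOUND on the rows with a prime
# `ℓ ≡ ±1 (mod 9)` in `Σ₀`, where the classes come from `λ`-units of the first layer
# `ℚ_1 = ℚ(ζ₉)⁺` of the cyclotomic tower; route K1 `AdditiveBranchIMC`, crux
# `GordTwoRankZeroOffCaseOne` — supports only)

HONEST FRAMING (cell `bsd-eis`, `run/shared/lean/pub/bsd-eis/README.md` §4): the programme's target of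
record is the full Birch–Swinnerton-Dyer formula for every `E/ℚ` of analytic rank `≤ 1`; this file is
pure Galois-cohomological tooling. THEOREMS ONLY (no `def`, no named fact, no `sorry`); nothing is
booked; no label, tier or count of record moves.

## Why

Greenberg–Vatsal's count on the degenerate rows reads `#H¹(ℚ_Σ/ℚ_∞, 𝔽_p)·#U(μ_p) = p^{λ + Σδ + 1}`
with `#U(μ_p) = p^{Σ_{ℓ∈Σ₀} s_ℓ − 1}`, `s_ℓ` = the number of primes of `ℚ_∞` above `ℓ`. gen 6
exhibited `#Σ₀ − 1` classes from RATIONAL `Σ₀`-units, which exhausts `U` exactly when every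
`s_ℓ = 1` (`ℓ ≢ ±1 (mod 9)` at `p = 3`). When `s_ℓ = 3` the three primes `λ₁, λ₂, λ₃` of the first
layer `ℚ_1` above `ℓ` carry three independent classes: the Kummer classes of `λ_j`-units of `ℚ_1`,
which are elements `a ∈ ℚ̄` fixed by `G' = Gal(ℚ̄/ℚ_1) = κ⁻¹(pℤ_p)` but not by `Γ_ℚ`. Their
cocycles `f(σ) = n_σ·y₀` (`σβ = ζ^{n_σ}β`, `β^p = a`) are crossed homomorphisms on `G'` only, and
`conj_τ` (`τ ∈ Γ_ℚ`) moves `[f_{a,β}]` to `[f_{τa,τβ}]` — so membership in `U` (unramified at EVERY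
place above every `v ∉ Σ₀`) is checked on the Galois conjugates of `a`.

## What (generic: `Ψ` an `ω`-line, `ζ` a primitive `p`-th root of unity, `G' ≤ Γ_ℚ`, `H ≤ G'`)

* §1 `exists_smul_eq_pow_mul`, `exists_kummerCocycle` — the Kummer cocycle of `β` (`β^p = a`,
  `a` fixed by `G'`): continuous on `Γ_ℚ`, crossed homomorphism ON `G'`, `f(σ) = n_σ y₀` for `σ ∈ G'`.
* §2 `exists_class_of_cocycle` (class on `H ≤ G'`), `conjH1_eq_of_kummer` (the conjugation formula:
  `conj_τ [f_{a,β}|_H] = [f'|_H]` for ANY `f'` with `f'(h) = m_h y₀`, `h(τβ) = ζ^{m_h} τβ`),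
  `class_eq_of_root_mul_pow` (changing the root `β ↦ ζ^jβ` does not change the class),
  `mem_unramifiedSelmer_of_conj` (membership in GV's `U` from conjugate representatives vanishing on
  the inertia groups).
* §3 `exists_fixed_root_of_coboundary` (a class that is a coboundary on `H` has an `H`-fixed root),
  `smul_eq_self_of_fixed_kerSubgroup` (`γ^p = A`, `A` fixed by `G' ⊇ ker κ`, `γ` fixed by `ker κ` ⟹
  `γ` fixed by `G'`: the cyclotomic character cannot die on `ker κ`, gen 6's
  `not_kerSubgroup_le_ker_cyclotomic`).

References: [SerreLocalFields1979] Ch. X §3 (Kummer theory), Ch. VII §5; [SerreGaloisCohomology1997]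
I.§2.3–2.5, I.§5.8; [GreenbergVatsal2000] §2 pp. 28–30; [Washington1997] §13.1; cell file
`run/shared/lean/pub/bsd-eis/x3-MEMO-9.md`.
-/

set_option autoImplicit false

noncomputable section

open scoped Classical AddSubgroup

namespace Summit.BirchSwinnertonDyer.Rank1Residual.Additive

namespace KummerLayerClasses

open NumberField IsDedekindDomain Field WeierstrassCurve
  Literature.NumberTheory.GaloisRepresentations
  Literature.NumberTheory.EllipticCurves
  Literature.NumberTheory.EllipticCurves.GreenbergSelmer
  Literature.NumberTheory.EllipticCurves.GreenbergVatsal2000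
  Literature.NumberTheory.EllipticCurves.Rank1Residual
  KummerLineClasses

variable {p : ℕ} [hp : Fact p.Prime]
  {Ψ : Type} [AddCommGroup Ψ] [DistribMulAction (absoluteGaloisGroup ℚ) Ψ]
  [TopologicalSpace Ψ] [DiscreteTopology Ψ]

/-! ### §1 The Kummer cocycle of a `p`-th root of an element fixed by `G'` -/

omit hp in
/-- **The exponent of a `p`-th root.** `ζ` a primitive `p`-th root of unity in `ℚ̄`, `β ∈ ℚ̄` with
`β^p = a ≠ 0`, and `σ ∈ Γ_ℚ` FIXING `a`: there is `n < p` with `σ β = ζ^n β`. [folklore] -/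
theorem exists_smul_eq_pow_mul [NeZero p] {ζ : AlgebraicClosure ℚ} (hζ : IsPrimitiveRoot ζ p)
    {a β : AlgebraicClosure ℚ} (ha : a ≠ 0) (hβ : β ^ p = a) {σ : absoluteGaloisGroup ℚ}
    (hσa : σ • a = a) : ∃ n : ℕ, n < p ∧ σ • β = ζ ^ n * β := by
  have hβ0 : β ≠ 0 := by
    rintro rfl
    rw [zero_pow (NeZero.ne p)] at hβ
    exact ha hβ.symm
  have hq : (σ • β / β) ^ p = 1 := by
    rw [div_pow, ← smul_pow', hβ, hσa, div_self ha]
  obtain ⟨n, hn, hζn⟩ := hζ.eq_pow_of_pow_eq_one hq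
  exact ⟨n, hn, by rw [hζn, div_mul_cancel₀ _ hβ0]⟩

omit [DiscreteTopology Ψ] in
/-- **The Kummer cocycle of a `p`-th root of an element of a subfield, with values in an `ω`-LINE.**
`Ψ` a discrete `Γ_ℚ`-module on which `σ` acts as the scalar `χ_p(σ)`, `y₀ ∈ Ψ` with `p·y₀ = 0`,
`ζ ∈ ℚ̄` a primitive `p`-th root of unity, `G' ≤ Γ_ℚ`, `a ∈ ℚ̄ˣ` fixed by `G'`, `β^p = a`. Then there
is a continuous `f : Γ_ℚ → Ψ` which ON `G'` is a crossed homomorphism with `f(σ) = n_σ·y₀`,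
`σβ = ζ^{n_σ}β` — the Kummer cocycle of `a` over the fixed field of `G'`, transported along
`μ_p ≅ Ψ`, `ζ ↦ y₀`. Stated as an existence (no definition). [cite: SerreLocalFields1979, Ch. X §3] -/
theorem exists_kummerCocycle [NeZero ((p : ℕ) : ℚ)] (G' : Subgroup (absoluteGaloisGroup ℚ))
    (hΨ : ∀ (σ : absoluteGaloisGroup ℚ) (y : Ψ),
      σ • y = ((modNCyclotomicCharacter ℚ p σ : (ZMod p)ˣ) : ZMod p).val • y)
    (y₀ : Ψ) (hy₀ : p • y₀ = 0) {ζ : AlgebraicClosure ℚ} (hζ : IsPrimitiveRoot ζ p)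
    {a β : AlgebraicClosure ℚ} (ha : a ≠ 0) (haG : ∀ σ ∈ G', σ • a = a) (hβ : β ^ p = a) :
    ∃ f : absoluteGaloisGroup ℚ → Ψ, Continuous f ∧
      (∀ σ ∈ G', ∀ τ ∈ G', f (σ * τ) = f σ + σ • f τ) ∧
      ∀ σ ∈ G', ∃ n : ℕ, σ • β = ζ ^ n * β ∧ f σ = n • y₀ := by
  haveI : NeZero p := ⟨hp.out.ne_zero⟩
  have hβ0 : β ≠ 0 := by
    rintro rfl
    rw [zero_pow hp.out.ne_zero] at hβ
    exact ha hβ.symm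
  -- the exponent as a function of the conjugate `x = σβ`
  let nOf : AlgebraicClosure ℚ → ℕ := fun x ↦
    if h : ∃ n : ℕ, n < p ∧ x = ζ ^ n * β then Classical.choose h else 0
  have hnOf : ∀ σ ∈ G', σ • β = ζ ^ nOf (σ • β) * β := fun σ hσ ↦ by
    have h : ∃ n : ℕ, n < p ∧ σ • β = ζ ^ n * β := by
      obtain ⟨n, hn, h⟩ := exists_smul_eq_pow_mul hζ ha hβ (haG σ hσ); exact ⟨n, hn, h⟩
    simp only [nOf, dif_pos h]
    exact (Classical.choose_spec h).2
  -- `p`-torsion bookkeeping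
  have hmod : ∀ n m : ℕ, (n : ZMod p) = m → n • y₀ = m • y₀ := fun n m h ↦ by
    rw [nsmul_eq_mod_nsmul n hy₀, nsmul_eq_mod_nsmul m hy₀, (ZMod.natCast_eq_natCast_iff' n m p).mp h]
  have hζp : ζ ^ p = 1 := hζ.pow_eq_one
  refine ⟨fun σ ↦ nOf (σ • β) • y₀, ?_, fun σ hσ τ hτ ↦ ?_, fun σ hσ ↦ ⟨nOf (σ • β), hnOf σ hσ, rfl⟩⟩
  · -- continuity: locally constant through the orbit map
    exact ((isLocallyConstant_smul β).comp (fun x ↦ nOf x • y₀)).continuous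
  · -- the cocycle identity on `G'` from `σζ = ζ^{χ_p(σ)}`
    set nσ := nOf (σ • β) with hnσ
    set nτ := nOf (τ • β) with hnτ
    set nστ := nOf ((σ * τ) • β) with hnστ
    have hσ' : σ • β = ζ ^ nσ * β := hnOf σ hσ
    have hτ' : τ • β = ζ ^ nτ * β := hnOf τ hτ
    have hστ' : (σ * τ) • β = ζ ^ nστ * β := hnOf (σ * τ) (G'.mul_mem hσ hτ)
    have h1 : (σ * τ) • β =
        ζ ^ (nσ + ((modNCyclotomicCharacter ℚ p σ : (ZMod p)ˣ) : ZMod p).val * nτ) * β := by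
      rw [mul_smul, hτ', smul_mul', smul_pow', modNCyclotomicCharacter_spec ℚ p σ ζ hζp, hσ',
        ← pow_mul, ← mul_assoc, ← pow_add, add_comm]
    rw [hστ'] at h1
    have h3 := natCast_eq_of_pow_mul_eq hζ hβ0 h1
    change nστ • y₀ = nσ • y₀ + σ • (nτ • y₀)
    rw [hmod _ _ h3, add_nsmul, smul_comm σ nτ y₀, hΨ σ y₀, ← mul_nsmul', mul_comm]

/-! ### §2 Classes in `H¹(H, Ψ)` (`H ≤ G'`): restriction, the conjugation formula, local vanishing -/

section Classes

variable (H : Subgroup (absoluteGaloisGroup ℚ)) [H.Normal]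

omit hp [H.Normal] in
/-- **The class `[f|_H] ∈ H¹(H, Ψ)` of a continuous map that is a crossed homomorphism on
`G' ⊇ H`**, with its cocycle: an existence statement recording a representative. [folklore] -/
theorem exists_class_of_cocycle {G' : Subgroup (absoluteGaloisGroup ℚ)} (hHG : H ≤ G')
    (f : absoluteGaloisGroup ℚ → Ψ) (hc : Continuous f)
    (hf : ∀ σ ∈ G', ∀ τ ∈ G', f (σ * τ) = f σ + σ • f τ) :
    ∃ (F : contOneCocycles (discreteTopRep H Ψ)) (c : subgroupH1 H Ψ),
      (∀ h : H, F.1 h = f h) ∧ c = oneCocycleClass (discreteTopRep H Ψ) F := by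
  refine ⟨⟨⟨fun h : H ↦ f h, hc.comp continuous_subtype_val⟩, fun g h ↦ ?_⟩, _, fun h ↦ rfl, rfl⟩
  change f ((g : absoluteGaloisGroup ℚ) * h) = f g + (g : absoluteGaloisGroup ℚ) • f h
  exact hf g (hHG g.2) h (hHG h.2)

/-- **The conjugation formula for Kummer classes.** `τ ∈ Γ_ℚ`; `F` a cocycle on `H` whose values are
`F(h) = n_h·y₀` with `hβ = ζ^{n_h}β`, and `F'` one with `F'(h) = m_h·y₀`, `h(τβ) = ζ^{m_h}(τβ)`. Then
`conj_τ [F] = [F']` — indeed `τ·F(τ⁻¹hτ) = F'(h)` pointwise, because `τζ = ζ^{χ_p(τ)}` and `τ`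
acts on the `ω`-line `Ψ` by `χ_p(τ)`. So `conj_τ` carries the Kummer class of `(a, β)` to that of
`(τa, τβ)`. [cite: SerreGaloisCohomology1997, I.§5.8] [cite: SerreLocalFields1979, Ch. X §3] -/
theorem conjH1_eq_of_kummer [NeZero ((p : ℕ) : ℚ)]
    (hΨ : ∀ (σ : absoluteGaloisGroup ℚ) (y : Ψ),
      σ • y = ((modNCyclotomicCharacter ℚ p σ : (ZMod p)ˣ) : ZMod p).val • y)
    {y₀ : Ψ} (hy₀ : p • y₀ = 0) {ζ : AlgebraicClosure ℚ} (hζ : IsPrimitiveRoot ζ p)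
    {β : AlgebraicClosure ℚ} (hβ0 : β ≠ 0) (τ : absoluteGaloisGroup ℚ)
    (F F' : contOneCocycles (discreteTopRep H Ψ))
    (hF : ∀ h : H, ∃ n : ℕ, (h : absoluteGaloisGroup ℚ) • β = ζ ^ n * β ∧ F.1 h = n • y₀)
    (hF' : ∀ h : H, ∃ m : ℕ, (h : absoluteGaloisGroup ℚ) • (τ • β) = ζ ^ m * (τ • β) ∧
      F'.1 h = m • y₀) :
    conjH1 H Ψ τ (oneCocycleClass (discreteTopRep H Ψ) F) =
      oneCocycleClass (discreteTopRep H Ψ) F' := by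
  haveI : NeZero p := ⟨hp.out.ne_zero⟩
  have hζp : ζ ^ p = 1 := hζ.pow_eq_one
  have hτβ0 : τ • β ≠ 0 := by
    intro h
    apply hβ0
    have := congrArg (fun x ↦ τ⁻¹ • x) h
    simpa using this
  have hmod : ∀ n m : ℕ, (n : ZMod p) = m → n • y₀ = m • y₀ := fun n m h ↦ by
    rw [nsmul_eq_mod_nsmul n hy₀, nsmul_eq_mod_nsmul m hy₀, (ZMod.natCast_eq_natCast_iff' n m p).mp h]
  change resH1Hom (subgroupConj H τ) (DistribSMul.toAddMonoidHom Ψ τ) _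
    (oneCocycleClass (discreteTopRep H Ψ) F) = _
  unfold resH1Hom
  change (ContinuousCohomology.map (subgroupConj H τ) _ 1).hom (oneCocycleClass (discreteTopRep H Ψ) F) = _
  rw [map_oneCocycleClass]
  congr 1
  refine Subtype.ext (ContinuousMap.ext fun h ↦ ?_)
  rw [contOneCocycles.pullback_apply]
  change τ • F.1 (subgroupConj H τ h) = F'.1 h
  obtain ⟨n, hn, hFn⟩ := hF (subgroupConj H τ h)
  obtain ⟨m, hm, hFm⟩ := hF' h
  rw [subgroupConj_apply_coe] at hn
  -- `h(τβ) = τ((τ⁻¹hτ)β) = τ(ζ^n β) = ζ^{χ(τ) n} τβ`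
  have h1 : (h : absoluteGaloisGroup ℚ) • (τ • β) =
      ζ ^ (((modNCyclotomicCharacter ℚ p τ : (ZMod p)ˣ) : ZMod p).val * n) * (τ • β) := by
    have e : (h : absoluteGaloisGroup ℚ) • (τ • β) = τ • ((τ⁻¹ * h * τ) • β) := by
      rw [← mul_smul, ← mul_smul, ← mul_assoc, ← mul_assoc, mul_inv_cancel, one_mul]
    rw [e, hn, smul_mul', smul_pow', modNCyclotomicCharacter_spec ℚ p τ ζ hζp, ← pow_mul]
  rw [hm] at h1
  have h2 := natCast_eq_of_pow_mul_eq hζ hτβ0 h1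
  rw [hFn, hFm, smul_comm, hΨ τ y₀, ← mul_nsmul', hmod _ _ h2, mul_comm]

omit [H.Normal] in
/-- **Changing the root does not change the class.** If `F(h) = n_h y₀` (`hβ = ζ^{n_h}β`) and
`F'(h) = m_h y₀` (`h(ζ^jβ) = ζ^{m_h}ζ^jβ`) on `H`, then `[F] = [F']`: the difference is the
coboundary of `j·y₀`. [cite: SerreLocalFields1979, Ch. X §3] -/
theorem class_eq_of_root_mul_pow [NeZero ((p : ℕ) : ℚ)]
    (hΨ : ∀ (σ : absoluteGaloisGroup ℚ) (y : Ψ),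
      σ • y = ((modNCyclotomicCharacter ℚ p σ : (ZMod p)ˣ) : ZMod p).val • y)
    {y₀ : Ψ} (hy₀ : p • y₀ = 0) {ζ : AlgebraicClosure ℚ} (hζ : IsPrimitiveRoot ζ p)
    {β : AlgebraicClosure ℚ} (hβ0 : β ≠ 0) (j : ℕ)
    (F F' : contOneCocycles (discreteTopRep H Ψ))
    (hF : ∀ h : H, ∃ n : ℕ, (h : absoluteGaloisGroup ℚ) • β = ζ ^ n * β ∧ F.1 h = n • y₀)
    (hF' : ∀ h : H, ∃ m : ℕ, (h : absoluteGaloisGroup ℚ) • (ζ ^ j * β) = ζ ^ m * (ζ ^ j * β) ∧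
      F'.1 h = m • y₀) :
    oneCocycleClass (discreteTopRep H Ψ) F' = oneCocycleClass (discreteTopRep H Ψ) F := by
  haveI : NeZero p := ⟨hp.out.ne_zero⟩
  have hζp : ζ ^ p = 1 := hζ.pow_eq_one
  have hζ0 : ζ ^ j ≠ 0 := pow_ne_zero _ (hζ.ne_zero hp.out.ne_zero)
  have hmod : ∀ n m : ℕ, (n : ZMod p) = m → n • y₀ = m • y₀ := fun n m h ↦ by
    rw [nsmul_eq_mod_nsmul n hy₀, nsmul_eq_mod_nsmul m hy₀, (ZMod.natCast_eq_natCast_iff' n m p).mp h]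
  rw [← sub_eq_zero, ← oneCocycleClass_sub, oneCocycleClass_eq_zero_iff]
  refine ⟨j • y₀, fun h ↦ ?_⟩
  change F'.1 h - F.1 h = (h : absoluteGaloisGroup ℚ) • (j • y₀) - j • y₀
  obtain ⟨n, hn, hFn⟩ := hF h
  obtain ⟨m, hm, hFm⟩ := hF' h
  set χ : ℕ := ((modNCyclotomicCharacter ℚ p h : (ZMod p)ˣ) : ZMod p).val with hχ
  -- `h(ζ^j β) = ζ^{χ j} ζ^n β`, so `m + j ≡ χ j + n`
  have h1 : (h : absoluteGaloisGroup ℚ) • (ζ ^ j * β) = ζ ^ (χ * j + n) * β := by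
    rw [smul_mul', smul_pow', modNCyclotomicCharacter_spec ℚ p h ζ hζp, ← hχ, hn, ← pow_mul,
      ← mul_assoc, ← pow_add]
  rw [hm, ← mul_assoc, ← pow_add] at h1
  have h2 := natCast_eq_of_pow_mul_eq hζ hβ0 h1
  have h3 : ((m + j : ℕ) : ZMod p) = ((χ * j + n : ℕ) : ZMod p) := h2
  rw [hFm, hFn, smul_comm, hΨ h y₀, ← hχ, ← mul_nsmul', sub_eq_sub_iff_add_eq_add, ← add_nsmul,
    ← add_nsmul]
  apply hmod
  push_cast at h3 ⊢
  linear_combination h3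

omit hp in
/-- **A class in GV's `U` from conjugate representatives.** If for every `τ ∈ Γ_ℚ` the conjugate
`conj_τ [F]` is represented by a cocycle `F_τ` agreeing on `H` with a function `f_τ : Γ_ℚ → Ψ` that
vanishes on the inertia group `I_v` of every finite `v ∉ S₀` (those above `p` INCLUDED), then
`[F] ∈ unramifiedSelmer H Ψ p S₀` (unramified at EVERY place above every `v ∉ S₀`).
[cite: GreenbergVatsal2000, §2 pp. 28–29] -/
theorem mem_unramifiedSelmer_of_conj (F : contOneCocycles (discreteTopRep H Ψ))
    (S₀ : Set (HeightOneSpectrum (𝓞 ℚ)))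
    (hconj : ∀ τ : absoluteGaloisGroup ℚ, ∃ (f' : absoluteGaloisGroup ℚ → Ψ)
      (F' : contOneCocycles (discreteTopRep H Ψ)), (∀ h : H, F'.1 h = f' h) ∧
      conjH1 H Ψ τ (oneCocycleClass (discreteTopRep H Ψ) F) = oneCocycleClass (discreteTopRep H Ψ) F' ∧
      (∀ v : HeightOneSpectrum (𝓞 ℚ), v ∉ S₀ → ∀ σ ∈ inertia v, f' σ = 0) ∧
      (∀ v : HeightOneSpectrum (𝓞 ℚ), ((p : ℕ) : 𝓞 ℚ) ∈ v.asIdeal → ∀ σ ∈ inertia v, f' σ = 0)) :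
    oneCocycleClass (discreteTopRep H Ψ) F ∈ unramifiedSelmer H Ψ p S₀ := by
  refine AddSubgroup.mem_inf.mpr ⟨?_, ?_⟩
  · rw [mem_unramifiedOutside_iff]
    intro v hvS _ τ
    obtain ⟨f', F', hF', hc, hv, -⟩ := hconj τ
    rw [hc]
    exact mem_unramifiedKer_of_cocycle H f' F' hF' v (hv v hvS)
  · simp only [AddSubgroup.mem_iInf, AddSubgroup.mem_comap]
    intro v hvp τ
    obtain ⟨f', F', hF', hc, -, hv⟩ := hconj τ
    rw [hc]
    exact mem_unramifiedKer_of_cocycle H f' F' hF' v (hv v hvp)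

end Classes

/-! ### §3 Injectivity: a Kummer class trivial on `G_{ℚ_∞}` has a `G'`-fixed `p`-th root -/

section Injective

omit [TopologicalSpace Ψ] [DiscreteTopology Ψ] in
/-- **A Kummer cocycle that is a coboundary on `H ≤ G'` has an `H`-fixed `p`-th root.** As gen 6's
`KummerLineClasses.exists_fixed_root_of_coboundary`, for `a ∈ ℚ̄` fixed by `G'` (the relation
`σβ = ζ^{n_σ}β`, `f(σ) = n_σ y₀` being asked on `G'` only): if `f|_H = ∂(t·y₀)` then `γ = ζ^{−t}β`
is fixed by `H` and `γ^p = a`. [cite: SerreLocalFields1979, Ch. X §3] -/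
theorem exists_fixed_root_of_coboundary [NeZero ((p : ℕ) : ℚ)]
    (hΨ : ∀ (σ : absoluteGaloisGroup ℚ) (y : Ψ),
      σ • y = ((modNCyclotomicCharacter ℚ p σ : (ZMod p)ˣ) : ZMod p).val • y)
    {y₀ : Ψ} (hy₀ : addOrderOf y₀ = p) (hgen : ∀ y : Ψ, ∃ t : ℕ, y = t • y₀)
    {ζ : AlgebraicClosure ℚ} (hζ : IsPrimitiveRoot ζ p) {a β : AlgebraicClosure ℚ} (hβ : β ^ p = a)
    {G' : Subgroup (absoluteGaloisGroup ℚ)} {f : absoluteGaloisGroup ℚ → Ψ}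
    (hf : ∀ σ ∈ G', ∃ n : ℕ, σ • β = ζ ^ n * β ∧ f σ = n • y₀)
    (H : Subgroup (absoluteGaloisGroup ℚ)) (hHG : H ≤ G') {y : Ψ}
    (hcob : ∀ h ∈ H, f h = h • y - y) :
    ∃ γ : AlgebraicClosure ℚ, γ ^ p = a ∧ ∀ h ∈ H, h • γ = γ := by
  haveI : NeZero p := ⟨hp.out.ne_zero⟩
  obtain ⟨t, rfl⟩ := hgen y
  set s : ℕ := p - t % p with hs
  have hst : ((s + t : ℕ) : ZMod p) = 0 := by
    have hlt : t % p < p := Nat.mod_lt _ hp.out.pos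
    have hsum : s + t % p = p := by omega
    rw [Nat.cast_add, ← ZMod.natCast_mod t p, ← Nat.cast_add, hsum, ZMod.natCast_self]
  refine ⟨ζ ^ s * β, ?_, fun h hh ↦ ?_⟩
  · rw [mul_pow, ← pow_mul, mul_comm s, pow_mul, hζ.pow_eq_one, one_pow, one_mul, hβ]
  · obtain ⟨n, hn, hfn⟩ := hf h (hHG hh)
    set χ : ℕ := ((modNCyclotomicCharacter ℚ p h : (ZMod p)ˣ) : ZMod p).val with hχ
    have h1 : ((n + t : ℕ) : ZMod p) = (t * χ : ℕ) := by
      have e := hcob h hh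
      rw [hfn, smul_comm, hΨ h y₀, ← hχ, ← mul_nsmul', eq_sub_iff_add_eq, ← add_nsmul] at e
      have e' := nsmul_inj_mod.mp e
      rw [hy₀] at e'
      exact (ZMod.natCast_eq_natCast_iff' _ _ p).mpr e'
    have h2 : ((χ * s + n : ℕ) : ZMod p) = s := by
      push_cast at h1 hst ⊢
      linear_combination h1 + ((χ : ZMod p) - 1) * hst
    rw [smul_mul', smul_pow', modNCyclotomicCharacter_spec ℚ p h ζ hζ.pow_eq_one, ← hχ, hn,
      ← pow_mul, ← mul_assoc, ← pow_add, pow_eq_pow_of_natCast_eq hζ h2]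

/-- **A `p`-th root of a `G'`-fixed element that is fixed by `G_{ℚ_∞}` is fixed by `G'`** (`κ` any
`ℤ_p`-extension of `ℚ`, `p` odd, `ker κ ≤ G'`). For `σ ∈ G'`, `σγ = ζ^iγ` and `ζ^i = σγ/γ` is fixed
by the normal subgroup `ker κ`; if `p ∤ i` the cyclotomic character would vanish on `ker κ`
(gen 6's `not_kerSubgroup_le_ker_cyclotomic`). So `γ` lies in the fixed field of `G'` — for
`G' = κ⁻¹(pℤ_p)`, in the first layer `ℚ_1`. [cite: Washington1997, §13.1] -/
theorem smul_eq_self_of_fixed_kerSubgroup [NeZero ((p : ℕ) : ℚ)] (hp2 : p ≠ 2)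
    (κ : ZpExtension ℚ p) {ζ : AlgebraicClosure ℚ} (hζ : IsPrimitiveRoot ζ p)
    {A γ : AlgebraicClosure ℚ} (hA : A ≠ 0) (hγ : γ ^ p = A)
    {G' : Subgroup (absoluteGaloisGroup ℚ)} (hAG : ∀ σ ∈ G', σ • A = A)
    (hfix : ∀ h ∈ κ.kerSubgroup, h • γ = γ) {σ : absoluteGaloisGroup ℚ} (hσ : σ ∈ G') :
    σ • γ = γ := by
  haveI : NeZero p := ⟨hp.out.ne_zero⟩
  have hγ0 : γ ≠ 0 := by
    rintro rfl
    rw [zero_pow hp.out.ne_zero] at hγ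
    exact hA hγ.symm
  obtain ⟨i, -, hσγ⟩ := exists_smul_eq_pow_mul hζ hA hγ (hAG σ hσ)
  -- `ζ^i` is fixed by `ker κ`
  have hfixζ : ∀ h ∈ κ.kerSubgroup, h • ζ ^ i = ζ ^ i := by
    intro h hh
    have hh' : σ⁻¹ * h * σ ∈ κ.kerSubgroup := conj_mem_of_normal κ.kerSubgroup σ ⟨h, hh⟩
    have e1 : h • (σ • γ) = σ • γ := by
      have := hfix _ hh'
      rw [mul_smul, mul_smul, inv_smul_eq_iff] at this
      exact this
    rw [hσγ, smul_mul', hfix h hh] at e1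
    exact mul_right_cancel₀ hγ0 e1
  by_cases hpi : p ∣ i
  · rw [hσγ, (hζ.pow_eq_one_iff_dvd i).mpr hpi, one_mul]
  · exfalso
    refine not_kerSubgroup_le_ker_cyclotomic hp2 κ fun h hh ↦ ?_
    have hζi : IsPrimitiveRoot (ζ ^ i) p := hζ.pow_of_coprime i
      ((Nat.coprime_comm).mp ((Nat.Prime.coprime_iff_not_dvd hp.out).mpr hpi))
    ext
    rw [Units.val_one, ← Nat.cast_one]
    exact modNCyclotomicCharacter_eq_of_smul_eq_pow ℚ p hζi h (by rw [pow_one]; exact hfixζ h hh)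

end Injective

end KummerLayerClasses

end Summit.BirchSwinnertonDyer.Rank1Residual.Additive
end
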